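/-
Copyright (c) 2026. All rights reserved.
Released under Apache 2.0 license as described in the file LICENSE.
-/
import Summits.Langlands.Langlands.Theorems.SoloInformedRepairR3plus
import Literature.NumberTheory.GaloisRepresentations.WeilLAdicCharacterLocalShape
import Literature.NumberTheory.GaloisRepresentations.CyclotomicCharacterArtinNormProofs
import Literature.NumberTheory.GaloisRepresentations.LocalArtinMapPinned
import Literature.NumberTheory.GaloisRepresentations.LabelledWeightsTateTwist
import Literature.NumberTheory.PAdicHodge.LocallyCyclotomicCharacterDeRham
import Literature.NumberTheory.Automorphic.GLOneArchParameterOfAlgebraicCharacter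
import HarnessLib

/-!
# Weil's character is de Rham at the locally parallel unramified places above `ℓ` — unconditionally

Soloist file (summit `Langlands`, conjunct `n = 1` in the R3⁺-repaired form of
`SoloInformedRepairR3plus` / `SoloInformedGLOneR3plus`).  Λ24 (`SoloInformedGLOneHodgeTateParallel`)
reduced the repaired `GL₁` conjunct over any number field `K` to two theorems in print about Weil's
character `r_{θ,ι} = hinf.weilRep hmod ι` of an algebraic Hecke character `θ` — dR₁ (`r_{θ,ι}` is
de Rham above `ℓ`, Serre III App. A5 / Fontaine) and FM₁ — plus, for NON-parallel `θ` only, HT₁ (its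
labelled Hodge–Tate weights).  The accepted reduction of dR₁ to local inputs
(`HeckeCharacter.exists_lAdic_isDeRhamFramed_of_local`) needs, at EVERY place `v ∣ ℓ`, the de Rham
property of potentially unramified representations (PU) and of the Lubin–Tate characters (LT).

This file removes both inputs at the places `v ∣ ℓ` where they are not needed.  Call `θ` (of
infinity type `(p, q)`) **locally parallel at `v` of exponent `n`** (relative to `ι : ℚ̄_ℓ ≃ ℂ`) if
`n_{ι∘e∘ι_v} = n` for every continuous `e : K_v → ℚ̄_ℓ` — automatic when `K_v` has a single
continuous embedding into `ℚ̄_ℓ` (e.g. `ℓ` split in `K`), and at every `v` when `θ` has parallel type.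

* §1 ★ `coe_weilRep_apply_of_mem_absInertia`: if `θ` is unramified at such a `v`, then ON INERTIA
  `r_{θ,ι}(σ) = ε_ℓ(σ)^{-n}` EXACTLY (`σ ∈ I_{K_v}`): Weil's local shape
  `r(w) = ι⁻¹(θ(⟨Art w⟩_v)) · ∏_e e(Art w)^{-n_e}` (`HasInfinityType.weilRep_toAbsGalois_apply`, THE
  local Artin map `canonicalArtin`, which carries inertia onto the units, `IsLocalArtinMap.image_inertia`),
  the first factor is `1` (`θ` unramified at `v`), and `∏_e e(x) = N_{K_v/ℚ_ℓ}(x)`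
  (`HodgeTateLabel.finprod_apply_eq_norm`) `= ε_ℓ(w)` for `x = Art w`, `w` inertial — Serre's
  `χ_ℓ = N ∘ Art` (`cyclotomicCharacter_toAbsGalois_eq_norm_canonicalArtin`, proved in the tree).
* §2 ★★ `isDeRhamFramed_weilRep_toLocal`: hence `r_{θ,ι}|_{Γ_{K_v}} = ψ ⊗ ε_ℓ^{-n}` with `ψ`
  UNRAMIFIED (`isLocallyUnramified_weilRep_toLocal_twist`), so `r_{θ,ι}|_{Γ_{K_v}}` is de Rham for THE
  pinned datum `fontainePstAdicCompletion v ℓ hv` — unconditionally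
  (`fontainePstAdicCompletion_isDeRhamFramed_unramified_tateTwist`: unramified ⇒ `B_dR`-admissible,
  Tate twists preserve admissibility) — with exactly one labelled Hodge–Tate weight at every continuous
  label (`exists_labelledHodgeTateWeightsAt_weilRep_eq_singleton`); in particular at every `v ∣ ℓ` with
  a unique continuous `K_v → ℚ̄_ℓ` (`isDeRhamFramed_weilRep_toLocal_of_forall_eq`).  No (PU), no (LT).
* §3 `labelledHodgeTateWeightsAt_weilRep_eq_singleton`, `hodgeTateCompatibleAt_weilRep_of_locallyParallel`:
  the VALUE of that weight is `n` — i.e. `(π, r_{θ,ι})` is Hodge–Tate compatible at `v` in the sense of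
  `R3plus.HodgeTateCompatibleAt` — as soon as unramified characters of `Γ_{K_v}` have `τ`-labelled
  weights `{0}` for the pinned datum (hypothesis `hLW`, the LABELLED form of Fontaine's clause (F3);
  the tree proves the unlabelled form `fontainePstAdicCompletion_unramifiedWeightsZero` and the labelled
  form for characters of finite image, `labelledHodgeTateWeightsAt_eq_replicate_zero_of_finite_range`,
  which Λ24 used; `ψ` here has infinite image in general).

Upshot for the summit's `n = 1` conjunct: at the locally parallel unramified places above `ℓ` the
de Rham clause of (A⁺)₁ for `r_{θ,ι}` is a theorem of the tree; what dR₁/HT₁ still import is confined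
to the places `v ∣ ℓ` where `θ` ramifies (potentially unramified ⊗ locally algebraic: (PU)) or is not
locally parallel (Lubin–Tate factors: (LT)), and, for the weight VALUES, the labelled clause (F3).
No definitions, no new named facts; hypotheses enter as binders.

Citations: [SerreAbelianLadic1968] Ch. III §1.1, §2.3, App. A.2 and A.5; [CasselsFrohlichANT1967]
Ch. VI (Serre, Local class field theory) §2.4, §3.1 Thm. 2; [SerreLocalFields1979] Ch. XIII §4;
[FontaineAsterisque223III] Exp. III Prop. 1.5.2, §3; [BrinonConrad2009] Prop. 8.3.4;
[Patrikis2019] §2.7.1, Cor. 2.2.3; [BuzzardGeeLMS2014] Conj. 3.2.2, Rem. 3.2.3; [Clozel1990] §3.3.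
-/

noncomputable section
open scoped MatrixGroups Matrix Classical Polynomial NumberField
open NumberField IsDedekindDomain Field Polynomial Filter
open Literature.NumberTheory.Automorphic Literature.NumberTheory.GaloisRepresentations
open Literature.NumberTheory.PAdicHodge

namespace Summit.Langlands.Langlands.Theorems

namespace GLOneRigidity

section LocallyParallel

variable {K : Type} [Field K] [NumberField K] {hcpt : isCompact_glFiniteIntegralLevel 1 K}
  {ℓ : ℕ} [Fact ℓ.Prime] {θ : HeckeCharacter K} {p q : InfinitePlace K → ℤ}
  {T : Finset (HeightOneSpectrum (𝓞 K))} {e : HeightOneSpectrum (𝓞 K) → ℕ}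

/-! ### §1 Weil's character on inertia at a locally parallel unramified place `v ∣ ℓ` -/

/-- **`r_{θ,ι} = ε_ℓ^{-n}` on the inertia group at `v ∣ ℓ`** when `θ` is unramified at `v` and
locally parallel at `v` of exponent `n`: for `σ ∈ I_{K_v}`,
`r_{θ,ι}(σ)₀₀ = (ε_ℓ(σ) : ℚ_ℓ)^{-n}` in `ℚ̄_ℓ`.  Weil's local shape at `v ∣ ℓ` for THE local Artin map,
`θ(⟨Art w⟩_v) = 1` (`Art w ∈ 𝒪_vˣ` for inertial `w`, `θ` unramified at `v`), and
`∏_{e : K_v → ℚ̄_ℓ} e(Art w) = N_{K_v/ℚ_ℓ}(Art w) = ε_ℓ(w)`.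
[cite: SerreAbelianLadic1968, Ch. III §1.1, §2.3 and App. A.2]
[cite: CasselsFrohlichANT1967, Ch. VI §3.1 Thm. 2 with §2.4] [cite: SerreLocalFields1979, Ch. XIII §4 Thm. 1] -/
theorem coe_weilRep_apply_of_mem_absInertia (ι : PadicAlgCl ℓ ≃+* ℂ)
    (hinf : θ.HasInfinityType p q) (hmod : HeckeCharacter.IsModulus θ T e)
    {v : HeightOneSpectrum (𝓞 K)} (hv : ((ℓ : ℕ) : 𝓞 K) ∈ v.asIdeal) (hθv : θ.IsUnramifiedAt v)
    {n : ℤ} (hn : ∀ f : v.adicCompletion K →+* PadicAlgCl ℓ, Continuous f →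
      HeckeCharacter.embExponent p q
        ((ι : PadicAlgCl ℓ →+* ℂ).comp (f.comp (algebraMap K (v.adicCompletion K)))) = n)
    {σ : absoluteGaloisGroup (v.adicCompletion K)} (hσ : σ ∈ absInertia (v.adicCompletion K)) :
    ((hinf.weilRep hmod ι (absGaloisRestrict K (v.adicCompletion K) σ) : GL (Fin 1) (PadicAlgCl ℓ)) :
        Matrix (Fin 1) (Fin 1) (PadicAlgCl ℓ)) 0 0 =
      (algebraMap ℚ_[ℓ] (PadicAlgCl ℓ)
        ((GaloisRep.cyclotomicCharacter (v.adicCompletion K) ℓ σ : ℤ_[ℓ]ˣ) : ℤ_[ℓ])) ^ (-n) := by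
  haveI := LocalField.charZero_adicCompletion v
  have hℓ := LocalField.valuation_adicCompletion_natCast_lt_one v ℓ hv
  -- `σ = w ∈ I(W_{K_v})`
  have hσ' : σ ∈ (WeilGroup.inertia (v.adicCompletion K)).map
      (WeilGroup.toAbsGalois (v.adicCompletion K)) := by
    rwa [WeilGroup.inertia_map_toAbsGalois]
  obtain ⟨w, hw, rfl⟩ := Subgroup.mem_map.1 hσ'
  -- Weil's local shape for THE local Artin map
  rw [hinf.weilRep_toAbsGalois_apply hmod ι
    (fun w hw => HeckeCharacter.isUnramifiedAt_of_isModulus' hmod hw) hv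
    (canonicalArtin (v.adicCompletion K)) (isLocalArtinMap_canonicalArtin_holds (v.adicCompletion K)) w]
  -- `Art w` is a unit and `θ` is unramified at `v`: the first factor is `1`
  have hval : Valued.v ((canonicalArtin (v.adicCompletion K) w : (v.adicCompletion K)ˣ) :
      v.adicCompletion K) = 1 := by
    have hmem : canonicalArtin (v.adicCompletion K) w ∈
        (ValuativeRel.valuation (v.adicCompletion K)).valuationSubring.unitGroup := by
      rw [← (isLocalArtinMap_canonicalArtin_holds (v.adicCompletion K)).image_inertia]
      exact Subgroup.mem_map_of_mem _ hw
    rw [Valuation.mem_unitGroup_iff] at hmem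
    exact ((ValuativeRel.isEquiv (ValuativeRel.valuation (v.adicCompletion K))
      (Valued.v : Valuation (v.adicCompletion K) (WithZero (Multiplicative ℤ)))).eq_one_iff_eq_one).1
      hmem
  rw [hθv.map_localUnits_eq_one _ hval, Units.val_one, map_one, one_mul]
  -- every exponent is `-n`
  have hexp : (∏ f : {e : v.adicCompletion K →+* PadicAlgCl ℓ // Continuous e},
        f.1 ((canonicalArtin (v.adicCompletion K) w : (v.adicCompletion K)ˣ) : v.adicCompletion K) ^
          (-HeckeCharacter.embExponent p q
            ((ι : PadicAlgCl ℓ →+* ℂ).comp (f.1.comp (algebraMap K (v.adicCompletion K)))))) =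
      ∏ f : {e : v.adicCompletion K →+* PadicAlgCl ℓ // Continuous e},
        f.1 ((canonicalArtin (v.adicCompletion K) w : (v.adicCompletion K)ˣ) : v.adicCompletion K) ^
          (-n) :=
    Finset.prod_congr rfl fun f _ => by rw [hn f.1 f.2]
  rw [hexp, Finset.prod_zpow]
  refine congrArg (fun t : PadicAlgCl ℓ => t ^ (-n)) ?_
  -- `∏_e e(Art w) = N_{K_v/ℚ_ℓ}(Art w) = ε_ℓ(w)`
  rw [cyclotomicCharacter_toAbsGalois_eq_norm_canonicalArtin ℓ (v.adicCompletion K) hℓ hw,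
    ← HodgeTateLabel.finprod_apply_eq_norm hℓ]
  haveI := HodgeTateLabel.finite_adicCompletion (ℓ := ℓ) v hv
  letI : Fintype (HodgeTateLabel (v.adicCompletion K) (PadicAlgCl ℓ)) := Fintype.ofFinite _
  rw [finprod_eq_prod_of_fintype]
  -- the labels `K_v →A[ℤ] ℚ̄_ℓ` carry `Ring.toIntAlgebra`, not the `𝓞 K`-tower instance of `K_v`
  letI : Algebra ℤ (v.adicCompletion K) := Ring.toIntAlgebra _
  let E : {e : v.adicCompletion K →+* PadicAlgCl ℓ // Continuous e} ≃
      HodgeTateLabel (v.adicCompletion K) (PadicAlgCl ℓ) :=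
    { toFun := fun f => ⟨f.1.toIntAlgHom, f.2⟩
      invFun := fun τ => ⟨τ.toAlgHom.toRingHom, τ.cont⟩
      left_inv := fun f => Subtype.ext (RingHom.ext fun _ => rfl)
      right_inv := fun τ => ContinuousAlgHom.ext fun _ => rfl }
  exact Fintype.prod_equiv E _ _ fun f => rfl

/-! ### §2 Unramified twist; de Rham at `v`, unconditionally -/

/-- **`r_{θ,ι}|_{Γ_{K_v}} ⊗ ε^{-1}` is unramified** for any continuous character `ε` of `Γ_{K_v}` with
values `ε_ℓ(σ)^{-n}` (e.g. `ε_ℓ^{-n}` itself, `exists_continuousMonoidHom_eq_cyclotomic_zpow`).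
[cite: SerreAbelianLadic1968, Ch. III §1.1 and App. A.2] -/
theorem isLocallyUnramified_weilRep_toLocal_twist (ι : PadicAlgCl ℓ ≃+* ℂ)
    (hinf : θ.HasInfinityType p q) (hmod : HeckeCharacter.IsModulus θ T e)
    {v : HeightOneSpectrum (𝓞 K)} (hv : ((ℓ : ℕ) : 𝓞 K) ∈ v.asIdeal) (hθv : θ.IsUnramifiedAt v)
    {n : ℤ} (hn : ∀ f : v.adicCompletion K →+* PadicAlgCl ℓ, Continuous f →
      HeckeCharacter.embExponent p q
        ((ι : PadicAlgCl ℓ →+* ℂ).comp (f.comp (algebraMap K (v.adicCompletion K)))) = n)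
    (ε : absoluteGaloisGroup (v.adicCompletion K) →ₜ* (PadicAlgCl ℓ)ˣ)
    (hε : ∀ σ, (ε σ : PadicAlgCl ℓ) =
      (algebraMap ℚ_[ℓ] (PadicAlgCl ℓ)
        ((GaloisRep.cyclotomicCharacter (v.adicCompletion K) ℓ σ : ℤ_[ℓ]ˣ) : ℤ_[ℓ])) ^ (-n)) :
    (((hinf.weilRep hmod ι).toLocal v).twist ε⁻¹).IsLocallyUnramified := by
  intro σ hσ
  refine Units.ext (Matrix.ext fun i j => ?_)
  obtain rfl : i = 0 := Subsingleton.elim _ _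
  obtain rfl : j = 0 := Subsingleton.elim _ _
  rw [FramedRep.coe_twist_apply, FramedGaloisRep.toLocal_apply, Matrix.smul_apply, smul_eq_mul,
    coe_weilRep_apply_of_mem_absInertia ι hinf hmod hv hθv hn hσ, ← hε σ, Units.val_one,
    Matrix.one_apply_eq]
  show (((ε σ)⁻¹ : (PadicAlgCl ℓ)ˣ) : PadicAlgCl ℓ) * (ε σ : PadicAlgCl ℓ) = 1
  rw [← Units.val_mul, inv_mul_cancel, Units.val_one]

/-- ★★ **Weil's character is de Rham at every locally parallel unramified place `v ∣ ℓ` — for THE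
pinned datum `fontainePstAdicCompletion v ℓ hv`, unconditionally.**  `r|_{Γ_{K_v}} = ψ ⊗ ε_ℓ^{-n}`
with `ψ` unramified; unramified representations are `B_dR(K_v)`-admissible and Tate twists preserve
admissibility (`fontainePstAdicCompletion_isDeRhamFramed_unramified_tateTwist`).
[cite: FontaineAsterisque223III, Exp. III Prop. 1.5.2 and §3] [cite: BrinonConrad2009, Prop. 8.3.4]
[cite: SerreAbelianLadic1968, Ch. III §1.1 and App. A.5] -/
theorem isDeRhamFramed_weilRep_toLocal (ι : PadicAlgCl ℓ ≃+* ℂ)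
    (hinf : θ.HasInfinityType p q) (hmod : HeckeCharacter.IsModulus θ T e)
    {v : HeightOneSpectrum (𝓞 K)} (hv : ((ℓ : ℕ) : 𝓞 K) ∈ v.asIdeal) (hθv : θ.IsUnramifiedAt v)
    {n : ℤ} (hn : ∀ f : v.adicCompletion K →+* PadicAlgCl ℓ, Continuous f →
      HeckeCharacter.embExponent p q
        ((ι : PadicAlgCl ℓ →+* ℂ).comp (f.comp (algebraMap K (v.adicCompletion K)))) = n) :
    (fontainePstAdicCompletion v ℓ hv).IsDeRhamFramed ((hinf.weilRep hmod ι).toLocal v) := by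
  obtain ⟨ε, hε⟩ := exists_continuousMonoidHom_eq_cyclotomic_zpow (p := ℓ) (v.adicCompletion K) (-n)
  have hψ := isLocallyUnramified_weilRep_toLocal_twist ι hinf hmod hv hθv hn ε hε
  have hdR := fontainePstAdicCompletion_isDeRhamFramed_unramified_tateTwist v hv hψ (-n) ε hε
  rwa [FramedRep.twist_twist, mul_inv_cancel, FramedRep.twist_one] at hdR

/-- **In particular at every `v ∣ ℓ` whose completion has a single continuous embedding into `ℚ̄_ℓ`**
(`K_v = ℚ_ℓ`, e.g. `ℓ` split completely in `K`) Weil's character of ANY algebraic Hecke character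
unramified at `v` is de Rham at `v`, unconditionally. [cite: SerreAbelianLadic1968, Ch. III §1.1 and App. A.5]
[cite: FontaineAsterisque223III, Exp. III Prop. 1.5.2] -/
theorem isDeRhamFramed_weilRep_toLocal_of_forall_eq (ι : PadicAlgCl ℓ ≃+* ℂ)
    (hinf : θ.HasInfinityType p q) (hmod : HeckeCharacter.IsModulus θ T e)
    {v : HeightOneSpectrum (𝓞 K)} (hv : ((ℓ : ℕ) : 𝓞 K) ∈ v.asIdeal) (hθv : θ.IsUnramifiedAt v)
    (e₀ : v.adicCompletion K →+* PadicAlgCl ℓ)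
    (h₁ : ∀ f : v.adicCompletion K →+* PadicAlgCl ℓ, Continuous f → f = e₀) :
    (fontainePstAdicCompletion v ℓ hv).IsDeRhamFramed ((hinf.weilRep hmod ι).toLocal v) :=
  isDeRhamFramed_weilRep_toLocal ι hinf hmod hv hθv
    (n := HeckeCharacter.embExponent p q
      ((ι : PadicAlgCl ℓ →+* ℂ).comp (e₀.comp (algebraMap K (v.adicCompletion K)))))
    fun f hf => by rw [h₁ f hf]

/-- **… with exactly one labelled Hodge–Tate weight at every continuous label `τ : K_v → ℚ̄_ℓ`**
(a de Rham character has one labelled weight: `B_dR(K_v)` is a field,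
`FramedGaloisRep.card_labelledHodgeTateWeightsAt_eq_of_isDeRhamFramed`).
[cite: Patrikis2019, §2.7.1] [cite: FontaineAsterisque223III, Exp. III Prop. 1.5.2] -/
theorem exists_labelledHodgeTateWeightsAt_weilRep_eq_singleton (ι : PadicAlgCl ℓ ≃+* ℂ)
    (hinf : θ.HasInfinityType p q) (hmod : HeckeCharacter.IsModulus θ T e)
    {v : HeightOneSpectrum (𝓞 K)} (hv : ((ℓ : ℕ) : 𝓞 K) ∈ v.asIdeal) (hθv : θ.IsUnramifiedAt v)
    {n : ℤ} (hn : ∀ f : v.adicCompletion K →+* PadicAlgCl ℓ, Continuous f →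
      HeckeCharacter.embExponent p q
        ((ι : PadicAlgCl ℓ →+* ℂ).comp (f.comp (algebraMap K (v.adicCompletion K)))) = n)
    (τ : v.adicCompletion K →+* PadicAlgCl ℓ) (hτ : Continuous τ) :
    ∃ a : ℤ, (hinf.weilRep hmod ι).labelledHodgeTateWeightsAt v
      (fontainePstAdicCompletion v ℓ hv).algebra (fontainePstAdicCompletion v ℓ hv).𝔅 τ = {a} :=
  Multiset.card_eq_one.1
    (FramedGaloisRep.card_labelledHodgeTateWeightsAt_eq_of_isDeRhamFramed (hinf.weilRep hmod ι) v hv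
      (isDeRhamFramed_weilRep_toLocal ι hinf hmod hv hθv hn) τ hτ)

/-! ### §3 The value of the weight, granting labelled weights zero for unramified characters -/

/-- **`HT_τ(r_{θ,ι}|_{Γ_{K_v}}) = {n}` at a locally parallel unramified place `v ∣ ℓ` of exponent `n`,
granting the labelled form of Fontaine's clause (F3) at `v`** (`hLW`: an unramified character of
`Γ_{K_v}` has `τ`-labelled Hodge–Tate weights `{0}` for the pinned datum, every continuous `τ`):
`r = ψ ⊗ ε_ℓ^{-n}`, `ψ` unramified, and Tate twists shift the labelled weights
(`fontainePstAdicCompletion_labelledHodgeTateWeights_twist_of_cyclotomic_zpow`, `HT(ε_ℓ) = -1`).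
[cite: FontaineAsterisque223III, Exp. III Prop. 1.5.2 and §3] [cite: SerreAbelianLadic1968, Ch. III §1.1 and App. A.5]
[cite: Patrikis2019, Cor. 2.2.3] -/
theorem labelledHodgeTateWeightsAt_weilRep_eq_singleton (ι : PadicAlgCl ℓ ≃+* ℂ)
    (hinf : θ.HasInfinityType p q) (hmod : HeckeCharacter.IsModulus θ T e)
    {v : HeightOneSpectrum (𝓞 K)} (hv : ((ℓ : ℕ) : 𝓞 K) ∈ v.asIdeal) (hθv : θ.IsUnramifiedAt v)
    {n : ℤ} (hn : ∀ f : v.adicCompletion K →+* PadicAlgCl ℓ, Continuous f →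
      HeckeCharacter.embExponent p q
        ((ι : PadicAlgCl ℓ →+* ℂ).comp (f.comp (algebraMap K (v.adicCompletion K)))) = n)
    (hLW : ∀ ψ : FramedRep (absoluteGaloisGroup (v.adicCompletion K)) (PadicAlgCl ℓ) 1,
      ψ.IsLocallyUnramified → ∀ τ : v.adicCompletion K →+* PadicAlgCl ℓ, Continuous τ →
        (letI := (fontainePstAdicCompletion v ℓ hv).algebra;
          (fontainePstAdicCompletion v ℓ hv).𝔅.labelledHodgeTateWeights
            (FramedRep.toContinuousRep ψ) τ) = ({0} : Multiset ℤ))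
    (τ : v.adicCompletion K →+* PadicAlgCl ℓ) (hτ : Continuous τ) :
    (hinf.weilRep hmod ι).labelledHodgeTateWeightsAt v
      (fontainePstAdicCompletion v ℓ hv).algebra (fontainePstAdicCompletion v ℓ hv).𝔅 τ = {n} := by
  letI := (fontainePstAdicCompletion v ℓ hv).algebra
  obtain ⟨ε, hε⟩ := exists_continuousMonoidHom_eq_cyclotomic_zpow (p := ℓ) (v.adicCompletion K) (-n)
  have hψ := isLocallyUnramified_weilRep_toLocal_twist ι hinf hmod hv hθv hn ε hε
  have hX : (hinf.weilRep hmod ι).toLocal v =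
      (((hinf.weilRep hmod ι).toLocal v).twist ε⁻¹).twist ε := by
    rw [FramedRep.twist_twist, mul_inv_cancel, FramedRep.twist_one]
  rw [FramedGaloisRep.labelledHodgeTateWeightsAt_def]
  change (fontainePstAdicCompletion v ℓ hv).𝔅.labelledHodgeTateWeights
      (FramedRep.toContinuousRep ((hinf.weilRep hmod ι).toLocal v)) τ = {n}
  rw [hX, fontainePstAdicCompletion_labelledHodgeTateWeights_twist_of_cyclotomic_zpow v hv _ (-n) ε hε τ,
    hLW _ hψ τ hτ, Multiset.map_singleton, sub_neg_eq_add, zero_add]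

/-- **Hence `(π, r_{θ,ι})` is Hodge–Tate compatible at every locally parallel unramified place `v ∣ ℓ`,
granting the labelled clause (F3) at `v`** — the clause `R3plus.HodgeTateCompatibleAt` of the repaired
summit (Buzzard–Gee recipe `{-a}`, Clozel's parameter `a_φ = -n_φ`), for `π` the automorphic
representation of `GL₁` with Hecke character `θ`.
[cite: BuzzardGeeLMS2014, Conj. 3.2.2 and Rem. 3.2.3] [cite: Clozel1990, §3.3]
[cite: SerreAbelianLadic1968, Ch. III §1.1] -/
theorem hodgeTateCompatibleAt_weilRep_of_locallyParallel (𝓡 : ReciprocityData K)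
    (ι : PadicAlgCl ℓ ≃+* ℂ) (π : AutomorphicRepData (AutomorphyDatum.gl 1 K hcpt))
    (hχ : ∀ (g : (AdelicGroupData.gl 1 K).Adelic), ∀ φ ∈ π.W,
      rightTranslation (AdelicGroupData.gl 1 K) g φ -
        ((θ (Matrix.GeneralLinearGroup.det g) : ℂˣ) : ℂ) • φ ∈ π.W')
    (hinf : θ.HasInfinityType p q) (hmod : HeckeCharacter.IsModulus θ T e)
    {v : HeightOneSpectrum (𝓞 K)} (hv : ((ℓ : ℕ) : 𝓞 K) ∈ v.asIdeal) (hθv : θ.IsUnramifiedAt v)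
    {n : ℤ} (hn : ∀ f : v.adicCompletion K →+* PadicAlgCl ℓ, Continuous f →
      HeckeCharacter.embExponent p q
        ((ι : PadicAlgCl ℓ →+* ℂ).comp (f.comp (algebraMap K (v.adicCompletion K)))) = n)
    (hLW : ∀ ψ : FramedRep (absoluteGaloisGroup (v.adicCompletion K)) (PadicAlgCl ℓ) 1,
      ψ.IsLocallyUnramified → ∀ τ : v.adicCompletion K →+* PadicAlgCl ℓ, Continuous τ →
        (letI := (fontainePstAdicCompletion v ℓ hv).algebra;
          (fontainePstAdicCompletion v ℓ hv).𝔅.labelledHodgeTateWeights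
            (FramedRep.toContinuousRep ψ) τ) = ({0} : Multiset ℤ)) :
    R3plus.HodgeTateCompatibleAt 𝓡 ι π (hinf.weilRep hmod ι) v hv := by
  obtain ⟨T₀, hT₀, hTa⟩ := π.exists_hasInfinityType_of_hasInfinityType_heckeCharacter_glOne hχ hinf
  rw [R3plus.hodgeTateCompatibleAt_iff_of_hasInfinityType hT₀]
  intro τ hτ
  have hW : (hinf.weilRep hmod ι).labelledHodgeTateWeightsAt v (𝓡.pst ℓ v hv).algebra
      (𝓡.pst ℓ v hv).𝔅 τ = {n} :=
    labelledHodgeTateWeightsAt_weilRep_eq_singleton ι hinf hmod hv hθv hn hLW τ hτ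
  have hnτ : HeckeCharacter.embExponent p q
      (ι.toRingHom.comp (τ.comp (algebraMap K (v.adicCompletion K)))) = n := hn τ hτ
  have hneg : ∀ s : Multiset ArchWeight,
      s.map (fun w : ArchWeight => -w.a) = (s.map ArchWeight.a).map Neg.neg := fun s => by
    rw [Multiset.map_map]; rfl
  rw [hW, InfinityType.hodgeTateWeights, hneg, hTa, hnτ]
  simp only [Multiset.map_singleton, neg_neg]

end LocallyParallel

end GLOneRigidity

end Summit.Langlands.Langlands.Theorems
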